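import Summits.ResolutionOfSingularities.ResolutionOfSingularities.Theorems.AbsoluteContactInsep
import Summits.ResolutionOfSingularities.ResolutionOfSingularities.Theorems.PPowerTowers
import Summits.ResolutionOfSingularities.ResolutionOfSingularities.Theorems.TameCutKernels
import Summits.ResolutionOfSingularities.ResolutionOfSingularities.Theorems.TameCutStage
import Summits.ResolutionOfSingularities.ResolutionOfSingularities.Theorems.LatencyCutCells
import Literature.AlgebraicGeometry.Resolution.DiffOpCoordinateSpan
import Literature.AlgebraicGeometry.Resolution.HasseSchmidtDiffEqDiffOp
import Mathlib.Algebra.Algebra.ZMod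
import HarnessLib

/-!
# ContactFreeIsPPower — COMPANION of lens-6 g19 (cross-lens; lens-4's window g24 «the EVERY-FIELD completion»)


[LANDING NOTE (decomp-res writer g8): tree file `Theorems/ContactFreeIsPPower.lean` = the lens-6 g19 COMPANION
`HOME/decomp-res-lens-6/g19/comp/ContactFreeIsPPower.lean` (sha256 272ae7a2…, 250 l; HOME =
run/shared/lean/pub/decomp-res) VERBATIM —
every import, namespace, section variable and declaration exactly as in the companion (the global
`linter.dupNamespace` option line dropped).  Critic: CRITIC-LEDGER row 147a (rider 2026-08-30T22:00:50Z: «land verbatim,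
--supports 28338»).  Host item: stmt-ResolutionOfSingularities-28338
`MaxContactCut.LCNoWildContactFreeOffLocusTowers` (statement
`HugValuationCut.NoWildContactFreeOffLocusTowers`, home `Theorems/LatencyCutCells`); this file makes its re-location to
`NoWildPPowerOffLocusTowers` (`Theorems/PPowerTowers`) EXACT and hypothesis-free (`noWildContactFreeOffLocusTowers_iff_pPower`).
Outside the Theses cone (imports cone-free tree modules only).]

ROOT DECOMPOSITION CELL decomp-res · lens 6 «barrier-complement carving» · generation 19 · COMPANION (not the node;
the node is `HOME/decomp-res-lens-6/g19/SubfieldContact.lean`).  Written in lens-4's TREE namespace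
`…Theorems.HugValuationCut` against TREE files only (all landed 2026-08-30): lens-6 g18 `Theorems.AbsoluteContactInsep`
(`hasQFrames`: an absolute `p^e`-frame at every CLOSED point of a regular local ring essentially of finite type over
ANY field), lens-6 g18 `Theorems.AbsoluteQFrame*` (the truncated Taylor morphism of a frame and its coefficients on
`u`-monomials), lens-4 g23 `Theorems.PPowerForm` (`PPowerFormAt`, the ring dictionary
`exists_mem_diffIdeal_of_not_pPower` over ANY field of scalars `k₀`, `not_isAbsContactAt_of_pPowerFormAt`), lens-4 g23
`Theorems.PPowerTowers` (`PPowerTower` and its cells; landed 2026-08-30T21:49Z), lens-4 g22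
`Theorems.LatencyCutCells` (`ContactFreeTower`, `NoWildContactFreeOffLocusTowers`), `Theorems.TameCutStage/Kernels`
(stage plumbing, `contactHugging_of_isAbsContactAt_root`).

## What is proved (KERNEL, 0 sorry, hypothesis-free — no perfectness, no `FGGround`, no separable residue field)

* §E1 `isAbsContactAt_of_not_pPowerFormAt_closed` / `isAbsContactAt_iff_not_pPowerFormAt_closed`: over EVERY field `K`
  of characteristic `p`, on an `IsBase` scheme, at every CLOSED point `y` with `ord_y 𝓘 = n ≥ 1`:
  ABSOLUTE CONTACT ⟺ THE INITIAL IDEAL IS NOT A `p`-POWER FORM.  (lens-4 g23 had it at every point over perfect and over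
  finitely generated fields; the closed points of towers over `k = 𝔽_p(t_1, t_2, …)`, `k((t))^{sep}`-type fields etc.
  were the gap.)  Proof: the truncated Taylor morphism `ψ : 𝒪 → 𝒪[X]/(X)^{p^n}` of an absolute `p^n`-frame
  (`hasQFrames`, which needs `κ(y)` finite over `K`, i.e. `y` closed) read as a `ZMod p`-algebra map is a truncated
  Hasse–Schmidt system of level `n` along a regular system of parameters with scalars the prime FIELD `ZMod p`
  (`h0` = `truncCoeff_zero_taylorHom`, Leibniz = `TruncPoly.hsCoeff_mul`, values on monomials = `hsCoeff_uMon` +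
  `hasseDeriv_monomial`, orders = `isDiffOpLE_of_hasseSystem`), to which lens-4's ring dictionary applies verbatim.
* §E2 stagewise and tower forms over EVERY field (marked points of forced towers are closed, `T.isClosed_pt`):
  `isAbsContactAt_stage_iff`, `contactFree_iff_forall_pPowerFormAt`, `contactHugging_of_not_pPowerFormAt_root_closed`,
  `pPowerFormAt_root_of_not_isAbsContactAt_closed`.
* §E3 (against lens-4 g23's TREE file `Theorems.PPowerTowers`: `PPowerTower`, `pPowerTower_iff`, the cells
  `WildPPowerOffLocusTowersTerminate` / `WildContactFreeNonPPowerOffLocusTowersTerminate`, `NoWildPPowerOffLocusTowers`,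
  `noWildContactFreeOffLocusTowers_iff_g23`): `contactFreeTower_iff_pPowerTower` over EVERY field; the non-`p`-power
contact-free wild off-locus bed is EMPTY
  OUTRIGHT (`wildContactFreeNonPPower_empty`, `noWildContactFreeNonPPowerOffLocusTowers_holds`), for every class and
  every weight (`contactFreeNonPPower_empty`); hence the EXACT, HYPOTHESIS-FREE re-location of the tree aside
  `NoWildContactFreeOffLocusTowers ⟺ NoWildPPowerOffLocusTowers` (`noWildContactFreeOffLocusTowers_iff_pPower`).

(Sources: EGAIV4 Thm. 16.11.2, Prop. 16.8.8; Matsumura1987 §27, §30 (Thm. 30.6); Kunz1969; Giraud1975;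
EncinasVillamayor2000 Thm. 4.9; CossartPiltant2008 Prop. 4.2.)
-/


noncomputable section

open CategoryTheory AlgebraicGeometry IsLocalRing
open Literature.AlgebraicGeometry.Resolution
open Summit.ResolutionOfSingularities.ResolutionOfSingularities.Theorems
open WeakOrderReduction ForcedTowerClasses DivergentTowerClasses MonomialTowerClasses
open HugDimensionClasses HugDimensionKernels SurfaceShadowClasses SurfaceShadowKernels
open NearPointCut (SingularClass)
open AbsoluteContactClasses (IsAbsContactAt SepResidueAt diffIdeal_restrict_le stalkMap_comp_toStalk_eq_stalkHom
  IsQFrame hasQFrames uMon uMon_eq_eval hsCoeff_uMon module_finite_residueField_of_isClosed)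
open scoped BigOperators

namespace Summit.ResolutionOfSingularities.ResolutionOfSingularities.Theorems.HugValuationCut

/-! ## §E1 THE TWO-WAY DICTIONARY AT CLOSED POINTS OVER EVERY FIELD -/

section EveryFieldPoint

open MvPolynomial

variable {K : Type} [Field K]

/-- **KERNEL (PROVED, ⟹ over EVERY field, CLOSED points): NOT a `p`-POWER FORM ⟹ ABSOLUTE CONTACT.**  `K` any field
of characteristic `p`, `Y` an `IsBase` scheme over `K`, `y` closed, `ord_y 𝓘 = n ≥ 1`, `¬ PPowerFormAt p 𝓘 n y`:
some absolute differential operator of order `≤ n − 1` sends an element of `𝓘_y` into `𝔪_y ∖ 𝔪_y²`.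
The absolute `p^n`-frame of lens-6 g18 at `y` supplies a truncated Hasse–Schmidt system with scalars `ZMod p`, and
lens-4 g23's ring dictionary `exists_mem_diffIdeal_of_not_pPower` concludes. (Sources: EGAIV4, Thm. 16.11.2;
Matsumura1987, Thm. 30.6; Giraud1975; EncinasVillamayor2000, Thm. 4.9.) -/
theorem isAbsContactAt_of_not_pPowerFormAt_closed {p : ℕ} (hp : p.Prime) [CharP K p] {Y : Scheme.{0}}
    (g : Y ⟶ Spec (.of K)) (hB : IsBase Y g) (I : Y.IdealSheafData) {n : ℕ} {y : Y}
    (hy : IsClosed ({y} : Set Y)) (hn : 0 < n) (hord : idealOrder I y = ((n : ℕ) : ℕ∞))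
    (h : ¬ PPowerFormAt p I n y) : IsAbsContactAt I n y := by
  obtain ⟨N, rfl⟩ : ∃ N, n = N + 1 := ⟨n - 1, by omega⟩
  obtain ⟨hle, hnle⟩ := stalkIdeal_le_and_not_le_of_idealOrder I y hord
  haveI : Fact p.Prime := ⟨hp⟩
  haveI : LocallyOfFiniteType g := hB.locallyOfFiniteType
  let S := Y.presheaf.stalk y
  letI algKS : Algebra K S := stalkAlgebra (g.appTop.hom.comp (Scheme.ΓSpecIso (.of K)).inv.hom) y
  haveI : Algebra.EssFiniteType K S := essFiniteType_stalk g y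
  haveI : IsRegularLocalRing S := hB.isRegular y
  haveI : Module.Finite K (ResidueField S) := module_finite_residueField_of_isClosed g hy
  haveI : CharP S p := charP_of_injective_algebraMap (algebraMap K S).injective p
  -- a regular system of parameters and an absolute `p^{N+1}`-frame at it (lens-6 g18 `hasQFrames`)
  obtain ⟨u, hu⟩ := exists_regularSystemOfParameters (R := S)
  obtain ⟨Cq, hF⟩ := hasQFrames p K S u rfl hu (N + 1) (Nat.succ_pos N)
  have hq : N + 1 < p ^ (N + 1) := Nat.lt_pow_self hp.one_lt
  -- the truncated Taylor morphism of the frame, as an algebra map over the prime FIELD `ZMod p`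
  letI algZ : Algebra (ZMod p) S := ZMod.algebra S p
  let ψ0 : S →+* MvPolynomial (Fin (maximalIdeal S).spanFinrank) S ⧸
      idealOfVars (Fin (maximalIdeal S).spanFinrank) S ^ (p ^ (N + 1)) := hF.taylorHom p (N + 1) rfl
  let ψ : S →ₐ[ZMod p] MvPolynomial (Fin (maximalIdeal S).spanFinrank) S ⧸
      idealOfVars (Fin (maximalIdeal S).spanFinrank) S ^ (p ^ (N + 1)) :=
    { ψ0 with
      commutes' := fun c =>
        RingHom.congr_fun (Subsingleton.elim (ψ0.comp (algebraMap (ZMod p) S)) (algebraMap (ZMod p) _)) c }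
  have hψ0 : ∀ b, TruncPoly.truncCoeff S (Fin _) (p ^ (N + 1)) 0 (ψ b) = b :=
    hF.truncCoeff_zero_taylorHom p (N + 1) rfl
  have hψu : ∀ i, ψ0.toIntAlgHom (u i) = Ideal.Quotient.mk _ (C (u i) + X i) := hF.taylorHom_u p (N + 1) rfl
  -- its coefficients: a truncated Hasse–Schmidt system of level `N + 1` along `u`, scalars `ZMod p`
  let Δ : (Fin (maximalIdeal S).spanFinrank →₀ ℕ) → (S →ₗ[ZMod p] S) :=
    fun α => TruncPoly.hsCoeff (p ^ (N + 1)) ψ α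
  have h0 : ∀ b, Δ 0 b = b := hψ0
  have hL : ∀ α : Fin (maximalIdeal S).spanFinrank →₀ ℕ, α.degree ≤ N + 1 → ∀ f f' : S,
      Δ α (f * f') = ∑ c ∈ Finset.HasAntidiagonal.antidiagonal α, Δ c.1 f * Δ c.2 f' :=
    fun α hα f f' => TruncPoly.hsCoeff_mul ψ (lt_of_le_of_lt hα hq) f f'
  have hV : ∀ α β : Fin (maximalIdeal S).spanFinrank →₀ ℕ, α.degree ≤ N + 1 →
      Δ α (∏ i, u i ^ β i) =
        ((∏ i ∈ α.support, (β i).choose (α i) : ℕ) : S) * ∏ i, u i ^ (β - α) i := by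
    intro α β hα
    have h1 : Δ α (∏ i, u i ^ β i) = TruncPoly.hsCoeff (p ^ (N + 1)) ψ0.toIntAlgHom α (uMon u β) := rfl
    rw [h1, hsCoeff_uMon ψ0.toIntAlgHom u hψu β α (lt_of_le_of_lt hα hq), hasseDeriv_monomial, map_mul,
      map_natCast, ← uMon_eq_eval]
    rfl
  have hD : ∀ (d : ℕ) (α : Fin (maximalIdeal S).spanFinrank →₀ ℕ), α.degree ≤ d → d ≤ N + 1 →
      IsDiffOpLE (ZMod p) d (Δ α) :=
    isDiffOpLE_of_hasseSystem (ZMod p) h0 hL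
  -- lens-4 g23's ring dictionary, contact side
  obtain ⟨x, hx, hx1, hx2⟩ := exists_mem_diffIdeal_of_not_pPower (p := p) hu h0 hL hV hD hle hnle h
  exact ⟨x, by rwa [Nat.add_sub_cancel], hx1, hx2⟩

/-- **THE TWO-WAY DICTIONARY AT CLOSED POINTS OVER EVERY FIELD (KERNEL, PROVED, hypothesis-free)**: `K` any field of
characteristic `p`, `Y` an `IsBase` scheme over `K`, `y` CLOSED, `ord_y 𝓘 = n ≥ 1`:
ABSOLUTE CONTACT ⟺ THE INITIAL IDEAL IS NOT A `p`-POWER FORM.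
(Sources: EGAIV4, Thm. 16.11.2, Prop. 16.8.8; Giraud1975; CossartPiltant2008, Prop. 4.2.) -/
theorem isAbsContactAt_iff_not_pPowerFormAt_closed {p : ℕ} (hp : p.Prime) [CharP K p] {Y : Scheme.{0}}
    (g : Y ⟶ Spec (.of K)) (hB : IsBase Y g) (I : Y.IdealSheafData) {n : ℕ} {y : Y}
    (hy : IsClosed ({y} : Set Y)) (hn : 0 < n) (hord : idealOrder I y = ((n : ℕ) : ℕ∞)) :
    IsAbsContactAt I n y ↔ ¬ PPowerFormAt p I n y := by
  refine ⟨fun hc hP => ?_, isAbsContactAt_of_not_pPowerFormAt_closed hp g hB I hy hn hord⟩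
  haveI := Fact.mk hp
  haveI : LocallyOfFiniteType g := hB.locallyOfFiniteType
  letI := stalkAlgebra (g.appTop.hom.comp (Scheme.ΓSpecIso (.of K)).inv.hom) y
  haveI : CharP (Y.presheaf.stalk y) p :=
    charP_of_injective_algebraMap (algebraMap K (Y.presheaf.stalk y)).injective p
  exact not_isAbsContactAt_of_pPowerFormAt hn hP hc

/-- **COROLLARY (KERNEL): at a CLOSED point over EVERY field, a `p`-power form needs wild order** — `p ∣ n` is part
of `PPowerFormAt`; recorded as the contrapositive reading «no absolute contact ⟹ `p ∣ n` ∧ `p`-power form».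
[folklore] -/
theorem pPowerFormAt_of_not_isAbsContactAt_closed {p : ℕ} (hp : p.Prime) [CharP K p] {Y : Scheme.{0}}
    (g : Y ⟶ Spec (.of K)) (hB : IsBase Y g) (I : Y.IdealSheafData) {n : ℕ} {y : Y}
    (hy : IsClosed ({y} : Set Y)) (hn : 0 < n) (hord : idealOrder I y = ((n : ℕ) : ℕ∞))
    (h : ¬ IsAbsContactAt I n y) : PPowerFormAt p I n y ∧ p ∣ n := by
  have := (isAbsContactAt_iff_not_pPowerFormAt_closed hp g hB I hy hn hord).not_left.mp h
  exact ⟨this, this.1⟩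

end EveryFieldPoint

/-! ## §E2 STAGES AND ROOTS OF FORCED TOWERS OVER EVERY FIELD (marked points are closed) -/

section EveryFieldTower

variable {K : Type} [Field K]

/-- **KERNEL (PROVED): STAGEWISE DICTIONARY over EVERY field** — at every marked point of a forced tower with an
`IsBase` root over `K` and a datum root of weight `n ≥ 1`. [folklore] -/
theorem isAbsContactAt_stage_iff {p : ℕ} (hp : p.Prime) [CharP K p] {n : ℕ} (hn : 0 < n)
    (T : ForcedTower) (g : T.St 0 ⟶ Spec (.of K)) (hB : IsBase (T.St 0) g) (hD : IsDatum n (T.D 0)) (j : ℕ) :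
    IsAbsContactAt (T.D j).ideal n (T.pt j) ↔ ¬ PPowerFormAt p (T.D j).ideal n (T.pt j) :=
  isAbsContactAt_iff_not_pPowerFormAt_closed hp (toRoot T j ≫ g) (tower_isBase T g hB j) (T.D j).ideal
    (T.isClosed_pt j) hn (tower_idealOrder_pt_eq T g hB hD j)

/-- **KERNEL (PROVED): over EVERY field, CONTACT-FREE AT EVERY STAGE ⟺ `p`-POWER FORM AT EVERY MARKED POINT**
(g22's located residual predicate `ContactFreeTower`, re-typed EXACTLY through initial forms, no hypothesis on `K`).
(Sources: Giraud1975; EGAIV4, Thm. 16.11.2, Prop. 16.8.8.) -/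
theorem contactFree_iff_forall_pPowerFormAt {p : ℕ} (hp : p.Prime) [CharP K p] {n : ℕ} (hn : 0 < n)
    (T : ForcedTower) (g : T.St 0 ⟶ Spec (.of K)) (hB : IsBase (T.St 0) g) (hD : IsDatum n (T.D 0)) :
    ContactFreeTower n T ↔ ∀ j, PPowerFormAt p (T.D j).ideal n (T.pt j) :=
  forall_congr' fun j => by rw [isAbsContactAt_stage_iff hp hn T g hB hD j, not_not]

/-- **THE ROOT THEOREM over EVERY field (KERNEL, PROVED): a forced tower whose ROOT ideal is NOT a `p`-power form at the
root point hugs a regular hypersurface germ for ever** (`ContactHugging`, 31571's class). [folklore] -/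
theorem contactHugging_of_not_pPowerFormAt_root_closed {p : ℕ} (hp : p.Prime) [CharP K p] {n : ℕ} (hn : 0 < n)
    (T : ForcedTower) (g : T.St 0 ⟶ Spec (.of K)) (hB : IsBase (T.St 0) g) (hD : IsDatum n (T.D 0))
    (h : ¬ PPowerFormAt p (T.D 0).ideal n (T.pt 0)) : ContactHugging T := by
  obtain ⟨N, rfl⟩ : ∃ N, n = N + 1 := ⟨n - 1, by omega⟩
  exact contactHugging_of_isAbsContactAt_root T g hB hD
    (isAbsContactAt_of_not_pPowerFormAt_closed hp g hB (T.D 0).ideal (T.isClosed_pt 0) (by omega)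
      (tower_idealOrder_pt_eq T g hB hD 0) h)

/-- **CONTACT-FREE AT THE ROOT ⟹ `p`-POWER ROOT, over EVERY field (KERNEL, PROVED).** [folklore] -/
theorem pPowerFormAt_root_of_not_isAbsContactAt_closed {p : ℕ} (hp : p.Prime) [CharP K p] {n : ℕ} (hn : 0 < n)
    (T : ForcedTower) (g : T.St 0 ⟶ Spec (.of K)) (hB : IsBase (T.St 0) g) (hD : IsDatum n (T.D 0))
    (h : ¬ IsAbsContactAt (T.D 0).ideal n (T.pt 0)) : PPowerFormAt p (T.D 0).ideal n (T.pt 0) ∧ p ∣ n := by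
  have := (isAbsContactAt_stage_iff hp hn T g hB hD 0).not_left.mp h
  exact ⟨this, this.1⟩

end EveryFieldTower

/-! ## §E3 THE EVERY-FIELD COMPLETION: `ContactFreeTower ⟺ PPowerTower`; the non-`p`-power contact-free bed is EMPTY;
`NoWildContactFreeOffLocusTowers ⟺ NoWildPPowerOffLocusTowers` EXACT and hypothesis-free -/

section EveryFieldCompletion

variable {K : Type} [Field K]

/-- **THE TOWER DICTIONARY OVER EVERY FIELD (KERNEL, PROVED, hypothesis-free): CONTACT-FREE TOWER ⟺ `p`-POWER TOWER**
— lens-4 g23's `contactFreeTower_iff_pPowerTower_perfect/_fg` minus their binders. (Sources: Giraud1975; EGAIV4,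
Thm. 16.11.2, Prop. 16.8.8; Matsumura1987, Thm. 30.6.) -/
theorem contactFreeTower_iff_pPowerTower {p : ℕ} (hp : p.Prime) [CharP K p] {n : ℕ} (hn : 0 < n)
    (T : ForcedTower) (g : T.St 0 ⟶ Spec (.of K)) (hB : IsBase (T.St 0) g) (hD : IsDatum n (T.D 0)) :
    ContactFreeTower n T ↔ PPowerTower n T := by
  rw [pPowerTower_iff hp T g]
  exact contactFree_iff_forall_pPowerFormAt hp hn T g hB hD

/-- **KERNEL (PROVED, hypothesis-free): over EVERY ground field NO forced tower of ANY class is contact-free without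
being a `p`-power tower** — the whole non-`p`-power contact-free bed is EMPTY (all weights, all classes, all fields;
lens-4 g23 had the perfect and the finitely generated columns). [folklore] -/
theorem contactFreeNonPPower_empty {n : ℕ} (hn : 1 ≤ n) (A : ForcedTower → Prop) :
    NoTower n fun T => (A T ∧ ContactFreeTower n T) ∧ ¬ PPowerTower n T :=
  fun p hp k _ _ T g hB hD _ hP => hP.2 ((contactFreeTower_iff_pPowerTower hp (by omega) T g hB hD).mp hP.1.2)

/-- **KERNEL (PROVED, hypothesis-free): THE CELL (O, wild, contact-free, NOT `p`-power) IS EMPTY** — lens-4 g23's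
`WildContactFreeNonPPowerOffLocusTowersTerminate n` holds outright for every `n ≥ 1`. [folklore] -/
theorem wildContactFreeNonPPower_empty {n : ℕ} (hn : 1 ≤ n) : WildContactFreeNonPPowerOffLocusTowersTerminate n :=
  fun p hp _ k _ _ T g hB hD _ hP => hP.2 ((contactFreeTower_iff_pPowerTower hp (by omega) T g hB hD).mp hP.1.2)

/-- **BY NAME (KERNEL, PROVED): `NoWildContactFreeNonPPowerOffLocusTowers` HOLDS.** [folklore] -/
theorem noWildContactFreeNonPPowerOffLocusTowers_holds : NoWildContactFreeNonPPowerOffLocusTowers :=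
  fun _ hn => wildContactFreeNonPPower_empty hn

/-- **THE EXACT, HYPOTHESIS-FREE RE-LOCATION (KERNEL + pure logic): the tree aside `NoWildContactFreeOffLocusTowers`
(g22, `Theorems/LatencyCutCells`, item 28338) ⟺ `NoWildPPowerOffLocusTowers`** — the wild contact-free off-locus
residual IS the wild `p`-power off-locus residual, over every field. [folklore] -/
theorem noWildContactFreeOffLocusTowers_iff_pPower : NoWildContactFreeOffLocusTowers ↔ NoWildPPowerOffLocusTowers :=
  ⟨noWildPPowerOffLocusTowers_of_aside, fun h =>
    noWildContactFreeOffLocusTowers_iff_g23.mpr ⟨h, noWildContactFreeNonPPowerOffLocusTowers_holds⟩⟩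

/-- weightwise form of the re-location. [folklore] -/
theorem wildContactFreeOffLocus_iff_pPower {n : ℕ} (hn : 1 ≤ n) :
    WildContactFreeOffLocusTowersTerminate n ↔ WildPPowerOffLocusTowersTerminate n :=
  ⟨fun h => ((wildContactFreeOffLocus_iff_g23 hn).mp h).1, fun h =>
    (wildContactFreeOffLocus_iff_g23 hn).mpr ⟨h, wildContactFreeNonPPower_empty hn⟩⟩

end EveryFieldCompletion

end Summit.ResolutionOfSingularities.ResolutionOfSingularities.Theorems.HugValuationCut

end
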